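import Literature.AnabelianGeometry.SemiGraphs.TemperedPiExistence
import Literature.AnabelianGeometry.SemiGraphs.GaloisCountableOfStrictlyCoherent
import Literature.AnabelianGeometry.Anabelioids.ConnectedOfTransitive
import Literature.AnabelianGeometry.Anabelioids.FiniteEtaleLocalDictionary
import HarnessLib

/-!
# The Galois coverings `𝒢_N` of open subgroups `N ≤ π̂₁(𝒢) = Aut(fiberAt v₀)` ([SemiAnbd] Prop 3.6 p. 38)

Mochizuki, *Semi-graphs of anabelioids*, Publ. RIMS **42** (2006), §3 Prop. 3.6 p. 38 ("Let `{G_i → G}` be some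
cofinal collection of connected finite étale Galois coverings of `G` …"), Ex. 3.10 p. 44 ("an exhaustive sequence
of open characteristic subgroups of finite index"); the dictionary «open subgroups of `π̂₁` ↔ pointed connected
finite étale coverings» of [SGA1, Exp. V] as packaged by Mathlib's Galois categories (`functorToAction` is
full; `exists_obj_of_aut_action'`). [cite: MochizukiSemiAnbd2006, Prop 3.6 p.38]

abc-iut cell, layer L3, row **T54·E1-J2(b)** (`HOME/plan/GAP-LEDGER.md` G-w4d053-1, E1 junction; L3-lead α60;
seat abc-iut-w4-d048 gen 3).  For a connected semi-graph of anabelioids `𝒢 : ProfiniteSemiGraph` and an OPEN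
subgroup `N ≤ Aut(𝒢.fiberAt v₀)` of FINITE INDEX this file provides, in the Galois category `B(𝒢) =
𝒢.toAnab.BObj`:

* `objOfSubgroup hc N hNo` — an object `𝒢_N` whose fibre at `v₀` is `Aut F ⧸ N` as an `Aut F`-set
  (`fiberEquivQuotient`, `fiberEquivQuotient_smul`), with base point `basePt` = the coset `N` and
  **`stabilizer_basePt : Stab(basePt) = N`**;
* `isConnected_objOfSubgroup` (abc-iut-L6-t18's `isConnected_of_isPretransitive`) and
  **`isGalois_objOfSubgroup`** for NORMAL `N` (right translations of the group `Aut F ⧸ N` are equivariant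
  bijections, lifted to automorphisms by fullness: `exists_iso_of_equivariant`);
* `exists_hom_of_equivariant` (fullness of `functorToAction`), `exists_hom_of_le` (transitions
  `𝒢_N → 𝒢_{N′}` for `N ≤ N′`, base point to base point) and `exists_hom_of_le_stabilizer` (DOMINATION:
  `𝒢_N → X` onto any point `x` with `N ≤ Stab x`).

The towers built from a prescribed sequence of such `N` — in particular abc-iut-w4-d053's characteristic
open cores, open and of finite index by T54·E1b (`BoundedDegreeCoveringsFinite.lean`) — are in
`GaloisLevelDataOfCharCores.lean`.  Plumbing definitions (`objOfSubgroup`, `fiberEquivQuotient`, `basePt`)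
are CHOICES from existence statements; no `Prop` fact, no instance, no notation.  Nothing here takes a side
on [IUTchIII] Cor. 3.12.
-/

noncomputable section

namespace Literature.AnabelianGeometry.SemiGraphs

open CategoryTheory CategoryTheory.PreGaloisCategory Literature.AnabelianGeometry.Anabelioids
open scoped FintypeCatDiscrete

universe u

namespace ProfiniteSemiGraph

variable {𝒢 : ProfiniteSemiGraph.{u}}

/-! ### Objects of `B(𝒢)` realising the coset spaces `Aut F ⧸ N` -/

section ObjOfSubgroup

/-- The stabilisers of the cosets `g N` (`N` open in `Aut(fiberAt v₀)`) are open: they are the conjugates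
of `N`. [cite: MochizukiSemiAnbd2006, Prop 3.6 p.38] -/
theorem isOpen_stabilizer_quotient {v₀ : 𝒢.graph.Vertex} (N : Subgroup (Aut (𝒢.fiberAt v₀)))
    (hNo : IsOpen (N : Set (Aut (𝒢.fiberAt v₀)))) (y : Aut (𝒢.fiberAt v₀) ⧸ N) :
    IsOpen (MulAction.stabilizer (Aut (𝒢.fiberAt v₀)) y : Set (Aut (𝒢.fiberAt v₀))) := by
  induction y using QuotientGroup.induction_on with
  | H g =>
    have : (MulAction.stabilizer (Aut (𝒢.fiberAt v₀)) ((g : Aut (𝒢.fiberAt v₀)) :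
          Aut (𝒢.fiberAt v₀) ⧸ N) : Set (Aut (𝒢.fiberAt v₀))) =
        (fun σ => g⁻¹ * σ * g) ⁻¹' (N : Set (Aut (𝒢.fiberAt v₀))) := by
      ext σ
      simp only [SetLike.mem_coe, MulAction.mem_stabilizer_iff, Set.mem_preimage,
        MulAction.Quotient.smul_coe, QuotientGroup.eq, smul_eq_mul]
      rw [show (σ * g)⁻¹ * g = (g⁻¹ * σ * g)⁻¹ by group, inv_mem_iff]
    rw [this]
    exact hNo.preimage ((continuous_const.mul continuous_id).mul continuous_const)

/-- For an open subgroup `N ≤ Aut(fiberAt v₀)` of finite index there is an object of `B(𝒢)` whose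
fibre at `v₀` is `Aut F ⧸ N` as an `Aut F`-set ([SemiAnbd] Prop. 3.6 p. 38: the finite étale covering
attached to an open subgroup; `exists_obj_of_aut_action'`). [cite: MochizukiSemiAnbd2006, Prop 3.6 p.38] -/
theorem exists_obj_fiber_equiv_quotient (hc : 𝒢.graph.IsConnected) (v₀ : 𝒢.graph.Vertex)
    (N : Subgroup (Aut (𝒢.fiberAt v₀))) (hNo : IsOpen (N : Set (Aut (𝒢.fiberAt v₀))))
    [N.FiniteIndex] :
    ∃ (X : 𝒢.toAnab.BObj) (e : (𝒢.fiberAt v₀).obj X ≃ Aut (𝒢.fiberAt v₀) ⧸ N),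
      ∀ (σ : Aut (𝒢.fiberAt v₀)) (x : (𝒢.fiberAt v₀).obj X), e (σ • x) = σ • e x := by
  letI := SemiGraphOfAnabelioids.galoisCategory_bObj 𝒢.toAnab ⟨hc⟩
  haveI := 𝒢.fiberFunctor_fiberAt hc v₀
  haveI : Finite (Aut (𝒢.fiberAt v₀) ⧸ N) := Subgroup.finite_quotient_of_finiteIndex
  exact SemiGraphOfAnabelioids.exists_obj_of_aut_action' (𝒢.fiberAt v₀) (Aut (𝒢.fiberAt v₀) ⧸ N)
    (isOpen_stabilizer_quotient N hNo)

/-- **The covering `𝒢_N → 𝒢` of an open finite-index subgroup `N ≤ π̂₁(𝒢) = Aut(fiberAt v₀)`** as an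
object of `B(𝒢)` (a choice). [cite: MochizukiSemiAnbd2006, Prop 3.6 p.38] -/
def objOfSubgroup (hc : 𝒢.graph.IsConnected) {v₀ : 𝒢.graph.Vertex} (N : Subgroup (Aut (𝒢.fiberAt v₀)))
    (hNo : IsOpen (N : Set (Aut (𝒢.fiberAt v₀)))) [N.FiniteIndex] : 𝒢.toAnab.BObj :=
  (exists_obj_fiber_equiv_quotient hc v₀ N hNo).choose

/-- The identification of the fibre of `𝒢_N` at `v₀` with `Aut F ⧸ N`.
[cite: MochizukiSemiAnbd2006, Prop 3.6 p.38] -/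
def fiberEquivQuotient (hc : 𝒢.graph.IsConnected) {v₀ : 𝒢.graph.Vertex}
    (N : Subgroup (Aut (𝒢.fiberAt v₀))) (hNo : IsOpen (N : Set (Aut (𝒢.fiberAt v₀)))) [N.FiniteIndex] :
    (𝒢.fiberAt v₀).obj (objOfSubgroup hc N hNo) ≃ Aut (𝒢.fiberAt v₀) ⧸ N :=
  (exists_obj_fiber_equiv_quotient hc v₀ N hNo).choose_spec.choose

/-- The identification is `Aut F`-equivariant. [cite: MochizukiSemiAnbd2006, Prop 3.6 p.38] -/
theorem fiberEquivQuotient_smul (hc : 𝒢.graph.IsConnected) {v₀ : 𝒢.graph.Vertex}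
    (N : Subgroup (Aut (𝒢.fiberAt v₀))) (hNo : IsOpen (N : Set (Aut (𝒢.fiberAt v₀)))) [N.FiniteIndex]
    (σ : Aut (𝒢.fiberAt v₀)) (x : (𝒢.fiberAt v₀).obj (objOfSubgroup hc N hNo)) :
    fiberEquivQuotient hc N hNo (σ • x) = σ • fiberEquivQuotient hc N hNo x :=
  (exists_obj_fiber_equiv_quotient hc v₀ N hNo).choose_spec.choose_spec σ x

/-- The base point of `𝒢_N`: the coset `N` itself. [cite: MochizukiSemiAnbd2006, Prop 3.6 p.38] -/
def basePt (hc : 𝒢.graph.IsConnected) {v₀ : 𝒢.graph.Vertex} (N : Subgroup (Aut (𝒢.fiberAt v₀)))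
    (hNo : IsOpen (N : Set (Aut (𝒢.fiberAt v₀)))) [N.FiniteIndex] :
    (𝒢.fiberAt v₀).obj (objOfSubgroup hc N hNo) :=
  (fiberEquivQuotient hc N hNo).symm ((1 : Aut (𝒢.fiberAt v₀)) : Aut (𝒢.fiberAt v₀) ⧸ N)

/-- **The stabiliser of the base point of `𝒢_N` is `N`.** [cite: MochizukiSemiAnbd2006, Prop 3.6 p.38] -/
theorem stabilizer_basePt (hc : 𝒢.graph.IsConnected) {v₀ : 𝒢.graph.Vertex}
    (N : Subgroup (Aut (𝒢.fiberAt v₀))) (hNo : IsOpen (N : Set (Aut (𝒢.fiberAt v₀)))) [N.FiniteIndex] :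
    MulAction.stabilizer (Aut (𝒢.fiberAt v₀)) (basePt hc N hNo) = N := by
  ext σ
  rw [MulAction.mem_stabilizer_iff, ← (fiberEquivQuotient hc N hNo).injective.eq_iff,
    fiberEquivQuotient_smul, basePt, Equiv.apply_symm_apply, ← MulAction.mem_stabilizer_iff,
    MulAction.stabilizer_quotient]

/-- `Aut F` acts transitively on the fibre of `𝒢_N` at `v₀`. [cite: MochizukiSemiAnbd2006, Prop 3.6 p.38] -/
theorem isPretransitive_fiber_objOfSubgroup (hc : 𝒢.graph.IsConnected) {v₀ : 𝒢.graph.Vertex}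
    (N : Subgroup (Aut (𝒢.fiberAt v₀))) (hNo : IsOpen (N : Set (Aut (𝒢.fiberAt v₀)))) [N.FiniteIndex] :
    MulAction.IsPretransitive (Aut (𝒢.fiberAt v₀)) ((𝒢.fiberAt v₀).obj (objOfSubgroup hc N hNo)) := by
  refine ⟨fun x y => ?_⟩
  obtain ⟨σ, hσ⟩ := MulAction.exists_smul_eq (Aut (𝒢.fiberAt v₀)) (fiberEquivQuotient hc N hNo x)
    (fiberEquivQuotient hc N hNo y)
  refine ⟨σ, (fiberEquivQuotient hc N hNo).injective ?_⟩
  rw [fiberEquivQuotient_smul, hσ]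

/-- `𝒢_N` is CONNECTED (transitive fibre; abc-iut-L6-t18's `isConnected_of_isPretransitive`).
[cite: MochizukiSemiAnbd2006, Prop 3.6 p.38] -/
theorem isConnected_objOfSubgroup (hc : 𝒢.graph.IsConnected) {v₀ : 𝒢.graph.Vertex}
    (N : Subgroup (Aut (𝒢.fiberAt v₀))) (hNo : IsOpen (N : Set (Aut (𝒢.fiberAt v₀)))) [N.FiniteIndex] :
    letI := SemiGraphOfAnabelioids.galoisCategory_bObj 𝒢.toAnab ⟨hc⟩
    PreGaloisCategory.IsConnected (objOfSubgroup hc N hNo) := by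
  letI := SemiGraphOfAnabelioids.galoisCategory_bObj 𝒢.toAnab ⟨hc⟩
  haveI := 𝒢.fiberFunctor_fiberAt hc v₀
  haveI : Nonempty ((𝒢.fiberAt v₀).obj (objOfSubgroup hc N hNo)) := ⟨basePt hc N hNo⟩
  haveI := isPretransitive_fiber_objOfSubgroup hc N hNo
  exact isConnected_of_isPretransitive (𝒢.fiberAt v₀) _

end ObjOfSubgroup

/-! ### Morphisms and automorphisms of `B(𝒢)` from equivariant maps of fibres (fullness) -/

section Fullness

/-- A morphism of `B(𝒢)` from an `Aut F`-EQUIVARIANT map of fibres at `v₀` (fullness of the fibre functor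
on finite `Aut F`-sets, Mathlib's `functorToAction_full`). [cite: MochizukiSemiAnbd2006, Prop 3.6 p.38] -/
theorem exists_hom_of_equivariant (hc : 𝒢.graph.IsConnected) (v₀ : 𝒢.graph.Vertex) (X Y : 𝒢.toAnab.BObj)
    (φ : (𝒢.fiberAt v₀).obj X → (𝒢.fiberAt v₀).obj Y)
    (hφ : ∀ (σ : Aut (𝒢.fiberAt v₀)) (x : (𝒢.fiberAt v₀).obj X), φ (σ • x) = σ • φ x) :
    ∃ f : X ⟶ Y, ∀ x, (𝒢.fiberAt v₀).map f x = φ x := by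
  letI := SemiGraphOfAnabelioids.galoisCategory_bObj 𝒢.toAnab ⟨hc⟩
  haveI := 𝒢.fiberFunctor_fiberAt hc v₀
  let h : (functorToAction (𝒢.fiberAt v₀)).obj X ⟶ (functorToAction (𝒢.fiberAt v₀)).obj Y :=
    { hom := FintypeCat.homMk φ
      comm := fun σ => by
        ext x
        exact hφ σ x }
  refine ⟨(functorToAction (𝒢.fiberAt v₀)).preimage h, fun x => ?_⟩
  have := congrArg (fun k => k.hom x) ((functorToAction (𝒢.fiberAt v₀)).map_preimage h)
  exact this

/-- An automorphism of an object of `B(𝒢)` from an `Aut F`-EQUIVARIANT bijection of its fibre at `v₀`.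
[cite: MochizukiSemiAnbd2006, Prop 3.6 p.38] -/
theorem exists_iso_of_equivariant (hc : 𝒢.graph.IsConnected) (v₀ : 𝒢.graph.Vertex) (X : 𝒢.toAnab.BObj)
    (ψ : (𝒢.fiberAt v₀).obj X ≃ (𝒢.fiberAt v₀).obj X)
    (hψ : ∀ (σ : Aut (𝒢.fiberAt v₀)) (x : (𝒢.fiberAt v₀).obj X), ψ (σ • x) = σ • ψ x) :
    ∃ τ : X ≅ X, ∀ x, (𝒢.fiberAt v₀).map τ.hom x = ψ x := by
  letI := SemiGraphOfAnabelioids.galoisCategory_bObj 𝒢.toAnab ⟨hc⟩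
  haveI := 𝒢.fiberFunctor_fiberAt hc v₀
  let i : (functorToAction (𝒢.fiberAt v₀)).obj X ≅ (functorToAction (𝒢.fiberAt v₀)).obj X :=
    Action.mkIso (FintypeCat.equivEquivIso ψ) fun σ => by
      ext x
      exact hψ σ x
  refine ⟨(functorToAction (𝒢.fiberAt v₀)).preimageIso i, fun x => ?_⟩
  have := congrArg (fun k => k.hom x) ((functorToAction (𝒢.fiberAt v₀)).map_preimage i.hom)
  exact this

end Fullness

/-! ### `𝒢_N` is Galois for normal `N`; transitions; domination -/

section Galois

/-- **`𝒢_N` is GALOIS when `N` is normal**: right translations of `Aut F ⧸ N` are `Aut F`-equivariant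
bijections, hence lift to automorphisms of `𝒢_N` acting transitively on the fibre.
[cite: MochizukiSemiAnbd2006, Prop 3.6 p.38] -/
theorem isGalois_objOfSubgroup (hc : 𝒢.graph.IsConnected) {v₀ : 𝒢.graph.Vertex}
    (N : Subgroup (Aut (𝒢.fiberAt v₀))) (hNo : IsOpen (N : Set (Aut (𝒢.fiberAt v₀)))) [N.FiniteIndex]
    [N.Normal] :
    letI := SemiGraphOfAnabelioids.galoisCategory_bObj 𝒢.toAnab ⟨hc⟩
    IsGalois (objOfSubgroup hc N hNo) := by
  letI := SemiGraphOfAnabelioids.galoisCategory_bObj 𝒢.toAnab ⟨hc⟩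
  haveI := 𝒢.fiberFunctor_fiberAt hc v₀
  haveI := isConnected_objOfSubgroup hc N hNo
  rw [isGalois_iff_pretransitive (𝒢.fiberAt v₀)]
  refine ⟨fun x y => ?_⟩
  let e := fiberEquivQuotient hc N hNo
  -- right translation by `(e x)⁻¹ * e y` on the group `Aut F ⧸ N`
  let R : Aut (𝒢.fiberAt v₀) ⧸ N ≃ Aut (𝒢.fiberAt v₀) ⧸ N := Equiv.mulRight ((e x)⁻¹ * e y)
  have hR : ∀ (σ : Aut (𝒢.fiberAt v₀)) (q : Aut (𝒢.fiberAt v₀) ⧸ N), R (σ • q) = σ • R q := by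
    intro σ q
    induction q using QuotientGroup.induction_on with
    | H g =>
      change ((σ • (g : Aut (𝒢.fiberAt v₀) ⧸ N)) * ((e x)⁻¹ * e y)) =
        σ • ((g : Aut (𝒢.fiberAt v₀) ⧸ N) * ((e x)⁻¹ * e y))
      rw [MulAction.Quotient.smul_coe, smul_eq_mul]
      obtain ⟨r, hr⟩ := QuotientGroup.mk_surjective ((e x)⁻¹ * e y)
      rw [← hr, ← QuotientGroup.mk_mul, ← QuotientGroup.mk_mul, MulAction.Quotient.smul_coe,
        smul_eq_mul, mul_assoc]
  obtain ⟨τ, hτ⟩ := exists_iso_of_equivariant hc v₀ (objOfSubgroup hc N hNo)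
    (e.trans (R.trans e.symm)) fun σ z => by
      change e.symm (R (e (σ • z))) = σ • e.symm (R (e z))
      apply e.injective
      rw [Equiv.apply_symm_apply, fiberEquivQuotient_smul, hR, fiberEquivQuotient_smul,
        Equiv.apply_symm_apply]
  refine ⟨τ, ?_⟩
  change (𝒢.fiberAt v₀).map τ.hom x = y
  rw [hτ]
  change e.symm (e x * ((e x)⁻¹ * e y)) = y
  rw [mul_inv_cancel_left, Equiv.symm_apply_apply]

/-- **Transition morphisms** `𝒢_N → 𝒢_{N'}` for `N ≤ N'`, mapping base point to base point.
[cite: MochizukiSemiAnbd2006, Prop 3.6 p.38] -/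
theorem exists_hom_of_le (hc : 𝒢.graph.IsConnected) {v₀ : 𝒢.graph.Vertex}
    (N N' : Subgroup (Aut (𝒢.fiberAt v₀))) (hNo : IsOpen (N : Set (Aut (𝒢.fiberAt v₀))))
    (hN'o : IsOpen (N' : Set (Aut (𝒢.fiberAt v₀)))) [N.FiniteIndex] [N'.FiniteIndex] (hle : N ≤ N') :
    ∃ f : objOfSubgroup hc N hNo ⟶ objOfSubgroup hc N' hN'o,
      (𝒢.fiberAt v₀).map f (basePt hc N hNo) = basePt hc N' hN'o := by
  let e := fiberEquivQuotient hc N hNo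
  let e' := fiberEquivQuotient hc N' hN'o
  obtain ⟨f, hf⟩ := exists_hom_of_equivariant hc v₀ (objOfSubgroup hc N hNo) (objOfSubgroup hc N' hN'o)
    (fun z => e'.symm (Subgroup.quotientMapOfLE hle (e z))) fun σ z => by
      apply e'.injective
      rw [Equiv.apply_symm_apply, fiberEquivQuotient_smul, fiberEquivQuotient_smul,
        Equiv.apply_symm_apply]
      induction e z using QuotientGroup.induction_on with
      | H g => rfl
  refine ⟨f, ?_⟩
  rw [hf]
  change e'.symm (Subgroup.quotientMapOfLE hle (e (e.symm _))) = e'.symm _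
  rw [Equiv.apply_symm_apply]
  rfl

/-- **Domination**: if `N` fixes a point `x` of the fibre of ANY object `X` (`N ≤ Stab x`), there is a
morphism `𝒢_N → X` taking the base point to `x` (the orbit map `Aut F ⧸ N → F(X)`).
[cite: MochizukiSemiAnbd2006, Prop 3.6 p.38] -/
theorem exists_hom_of_le_stabilizer (hc : 𝒢.graph.IsConnected) {v₀ : 𝒢.graph.Vertex}
    (N : Subgroup (Aut (𝒢.fiberAt v₀))) (hNo : IsOpen (N : Set (Aut (𝒢.fiberAt v₀)))) [N.FiniteIndex]
    (X : 𝒢.toAnab.BObj) (x : (𝒢.fiberAt v₀).obj X)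
    (hle : N ≤ MulAction.stabilizer (Aut (𝒢.fiberAt v₀)) x) :
    ∃ f : objOfSubgroup hc N hNo ⟶ X, (𝒢.fiberAt v₀).map f (basePt hc N hNo) = x := by
  let e := fiberEquivQuotient hc N hNo
  obtain ⟨f, hf⟩ := exists_hom_of_equivariant hc v₀ (objOfSubgroup hc N hNo) X
    (fun z => MulAction.ofQuotientStabilizer (Aut (𝒢.fiberAt v₀)) x
      (Subgroup.quotientMapOfLE hle (e z))) fun σ z => by
      rw [fiberEquivQuotient_smul]
      induction e z using QuotientGroup.induction_on with
      | H g =>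
        rw [MulAction.Quotient.smul_coe, smul_eq_mul, Subgroup.quotientMapOfLE_apply_mk,
          Subgroup.quotientMapOfLE_apply_mk, MulAction.ofQuotientStabilizer_mk,
          MulAction.ofQuotientStabilizer_mk, mul_smul]
  refine ⟨f, ?_⟩
  rw [hf]
  change MulAction.ofQuotientStabilizer _ x (Subgroup.quotientMapOfLE hle (e (e.symm _))) = x
  rw [Equiv.apply_symm_apply, Subgroup.quotientMapOfLE_apply_mk, MulAction.ofQuotientStabilizer_mk,
    one_smul]

end Galois

end ProfiniteSemiGraph

end Literature.AnabelianGeometry.SemiGraphs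

end
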